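import Summits.BirchSwinnertonDyer.BirchSwinnertonDyer.Theorems.ErratumRoadFiveNonSurjCornerKolyvagin
import Summits.BirchSwinnertonDyer.Rank1Residual.X11a.CMPartner
import Literature.NumberTheory.EllipticCurves.ExceptionalPrimesDensityModels

/-!
# Route `ErratumRoadFive` (rung K2a), crux 6 `NonSurjCorner` (item 19065): the corner on the Kolyvagin
# road with the TWIN's whole `p`-part read off the X11a cell's NON-SURJECTIVE LEAF by name
# (cell `bsd-stepL`, seat `bsd-stepL-corner-p1` g3, file 1 of 2; `--supports stmt-BirchSwinnertonDyer-19065`)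

Item 19065 is `Typed.MissingPPartAt W p` on the (T4′) corner of class X11b (`r_an = 1`, `p ∥ N`, `E[p]`
irreducible, `ρ̄_{E,p}` NOT onto, `p ∈ {5,7}`; `p ∣ ord_p Δ_min` and `¬`(ram) are then automatic). Sessions
g0 ∕ g2 (`ErratumRoadFiveNonSurjCorner{Upper,Lower,Index,Kolyvagin}.lean`) reduced it to four typed
inputs: the refined Kolyvagin conjecture `M_∞ = t := ord_p ∏_ℓ c_ℓ(E)` on the pair's Heegner frames, split
as **Zₚᶜ** (a certificate, `M_∞ ≤ t`) and **Jₚᶜ** (the Jetchev direction, `M_∞ ≥ t`), plus the two Miller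
halves of the rank-`0` TWIN `E^{(d_K)}`: its Euler-system half **hT** and the route's crux `X11aLowerHalf`
(19064, rung K6's object) on ALL of class X11a.

THIS FILE (session g3, file 1) sharpens the twin side:

* §0 `not_surj_twist_model` — `ρ̄_{E,p}` not onto ⟹ `ρ̄_{E^{(d)},p}` not onto for every model of every
  quadratic twist (twisting twice is a change of variables; tree lemmas
  `twistAdmissible_hasSurjectiveModNGaloisRep_smul_quadraticTwist`, `hasSurjectiveModNGaloisRep_smul_iff`).
  So the Heegner twin of a corner pair is a pair of the X11a cell's NON-SURJECTIVE LEAF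
  (`ClassX11a ∧ ¬Surj`, `p ∈ {5,7}`, `p ∣ ord_p Δ_min`) — the leaf whose typed input of record is Mazur's
  main conjecture at the pair, `X2.MazurMainConjectureAt` (`X11a/Cells.lean`, `X11a/EndState.lean`); and
  `missingPPartAt_of_classX11a_of_mazurMainConjectureAt` — both Miller halves of such a pair from that
  input (x11a's height-free glue).
* §1 `missingUpperBoundAt_corner_of_jetchevDivisibility_of_twinLeafLower` — g2's §3 (the corner's
  Euler-system half from Jₚᶜ + the SHARPENED `K`-bound under irreducibility) with the twist's `≥`-half
  asked ONLY on the non-surjective X11a leaf (not on all of X11a): crux `X11aLowerHalf` is no longer used.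
* §2 **`erratumRoadFive_nonSurjCorner_of_refinedKolyvagin_of_twinLeafMazurMC : pubs → Zₚᶜ → Jₚᶜ →
  (Mazur's MC on the non-surjective X11a leaf at p ∈ {5,7}) → NonSurjCorner`** — the corner = the refined
  Kolyvagin conjecture on its own frames + the X11a non-surjective leaf's input BY NAME; neither an
  `OpenInputIMC`-type input, nor `EulerHalfOffLocus` (19062), nor `X11aLowerHalf` (19064), nor an ad-hoc hT.

File 2 (`ErratumRoadFiveNonSurjCornerTwinLeafSub.lean`) records the two sub-corners (Tamagawa-unit: Jₚᶜ
vacuous; dihedral: the leaf input from a CM partner, Rubin 1991 ∘ Emerton–Pollack–Weston 2006).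

HONEST FRAMING. Zₚᶜ, Jₚᶜ and the leaf input are hypothesis SHAPES (no `def`, no named fact); nothing here
proves them; item 19065 does NOT close; the leaf is untouched; no census word moves. What the file buys: the
corner's residual beyond the refined Kolyvagin conjecture on its own frames is EXACTLY the X11a cell's
non-surjective-leaf input (rung K6's object of record, by name). CONDITIONAL throughout (flag
`Cha05-Rmk25-structure` on `hChaL` ∕ `hChaU` as in g2's files). Census of the corner (seat data
`corner57.tsv`, memo `CORNER-G3.md` on item 19065): 64 pairs at `p = 5` below `5·10⁵` (images `5S4` 52,
`5Ns` 12), none at `p = 7`.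

References: [Cha2005] Thm. 21, Rmk. 25; [MatarNekovar2019] Thm. 0.3, 0.7, §0.9, §0.11; [McCallumLMS1991]
§5 Cor. 5.6; [WZhang2014] Thm. 1.1, Rem. 5; [Jetchev2008] Conj. 1.3; [SteinWuthrich2013] Thm. 6.1;
[SilvermanAEC2009] X.5 Cor. 5.4, X.2 Prop. 2.4; [Serre1972] §2.4 Prop. 15; [JetchevSkinnerWan2017] §7.4;
tree: g0 ∕ g2's `Theorems/ErratumRoadFiveNonSurjCorner*.lean`, x11a's `Rank1Residual/X11a/{Cells,EndState,
ChainHeightFree,CMPartner}.lean`.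
-/

noncomputable section

open scoped Classical NumberField

namespace Summit.BirchSwinnertonDyer.Rank1Residual.X11b

open WeierstrassCurve NumberField IsDedekindDomain Field Literature.NumberTheory.EllipticCurves
  Literature.NumberTheory.EllipticCurves.ModularForms
  Literature.NumberTheory.EllipticCurves.Rank1Residual
  Literature.NumberTheory.EllipticCurves.Rank1Residual.Typed
  Literature.NumberTheory.EllipticCurves.Wuthrich2014
  Literature.NumberTheory.EllipticCurves.SteinWuthrich2013
  Literature.NumberTheory.EllipticCurves.GreenbergVatsal2000
  Literature.NumberTheory.EllipticCurves.EmertonPollackWeston2006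
  Literature.NumberTheory.QuadraticFields.Quadratic
  Summit.BirchSwinnertonDyer.Rank1Residual
  Summit.BirchSwinnertonDyer.Rank1Residual.X11b.Three.Koly

/-! ### §0 Non-surjectivity passes to quadratic twists; both Miller halves of a leaf twin from Mazur's MC -/

/-- **`ρ̄_{E,p}` NOT onto ⟹ `ρ̄_{E^{(d)},p}` NOT onto**, for every `d ≠ 0` and every model `Cd • W^{(d)}`
of the twist: if the twist's representation were onto, so would be that of its own twist by `d`
(`twistAdmissible_hasSurjectiveModNGaloisRep_smul_quadraticTwist`), and `(W^{(d)})^{(d)} = W^{(d²)}` is a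
change of variables of `W` (`quadraticTwist_quadraticTwist`, `exists_variableChange_smul_eq_quadraticTwist_sq`,
`hasSurjectiveModNGaloisRep_smul_iff`). Equivalently: the images of `ρ̄_{E,p}` and
`ρ̄_{E^{(d)},p} ≅ ρ̄_{E,p} ⊗ χ_d` agree up to the centre. [cite: SilvermanAEC2009, X.5 Cor. 5.4 and X.2 Prop. 2.4] -/
theorem not_surj_twist_model (W : WeierstrassCurve ℚ) [W.IsElliptic] (p : ℕ) [Fact p.Prime]
    {d : ℚ} (hd : d ≠ 0) (hns : ¬ Surj W p) {Wd : WeierstrassCurve ℚ} (Cd : VariableChange ℚ)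
    (hWd : Cd • W.quadraticTwist d = Wd) : ¬ Surj Wd p := by
  intro hsd
  apply hns
  have h1 : Surj (W.quadraticTwist d) p := by
    rw [← hWd] at hsd
    exact (hasSurjectiveModNGaloisRep_smul_iff (W.quadraticTwist d) Cd (p : ℤ)).mp hsd
  haveI : (W.quadraticTwist d).IsElliptic := W.isElliptic_quadraticTwist hd
  have h2 := Summit.BirchSwinnertonDyer.BirchSwinnertonDyer.Theorems.twistAdmissible_hasSurjectiveModNGaloisRep_smul_quadraticTwist
    (W.quadraticTwist d) hd (1 : VariableChange ℚ) p h1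
  rw [one_smul, quadraticTwist_quadraticTwist, ← sq] at h2
  obtain ⟨D, hD⟩ := W.exists_variableChange_smul_eq_quadraticTwist_sq hd
  rw [← hD] at h2
  exact (hasSurjectiveModNGaloisRep_smul_iff W D (p : ℤ)).mp h2

/-- **Mazur's main conjecture at an X11a pair ⇒ its whole `p`-part in Miller's currency** (both halves;
any image): the X11a cell's height-free glue `X11a.bsdp_of_mazurMainConjectureAt_heightFree` (Stein–Wuthrich
2013 Thm. 6.1 `hJs`/`hJn`, Greenberg–Stevens `hGS`, GZK, modularity `hmod`/`hpar`) gives `BSD(E^d,p)`, whence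
`Typed.MissingPPartAt` (`Typed.missingPPartAt_of_bsdp`). CONDITIONAL on `hMC`.
[cite: SteinWuthrich2013, Thm. 6.1 (p. 20) and §4.2]
[cite: Skinner2016PacificMC, Thm. A (§1) (shape of hMC; nothing asserted)] [cite: Miller2011LMS, Def. 1.1] -/
theorem missingPPartAt_of_classX11a_of_mazurMainConjectureAt
    (hJs : thm61_splitMultiplicative) (hJn : thm61_nonsplitMultiplicative)
    (hGZK : rank_eq_analyticRank_of_analyticRank_le_one) (hmod : hasEntireLFunction_rat)
    (hpar : nonempty_modularParametrizationData)
    (Wd : WeierstrassCurve ℚ) [Wd.IsElliptic] [Wd.IsGloballyMinimal] (p : ℕ) [Fact p.Prime]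
    (hGS : greenberg_stevens (W := Wd) (p := p))
    (hXa : ClassX11a Wd p) (hMC : X2.MazurMainConjectureAt Wd p) :
    Typed.MissingPPartAt Wd p := by
  have hb : BSDp Wd p := X11a.bsdp_of_mazurMainConjectureAt_heightFree hJs hJn hGZK hmod hpar hGS hXa hMC
  haveI : Finite Wd.sha := (hGZK Wd (by rw [hXa.1]; exact zero_le_one)).2
  exact Typed.missingPPartAt_of_bsdp Wd p hb

/-! ### §1 The corner's Euler-system half from Jₚᶜ + the `≥`-half of the NON-SURJECTIVE-LEAF twin -/

/-- **The Euler-system half `Typed.MissingUpperBoundAt W p` on the corner from the JETCHEV DIRECTION on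
the pair's frames + the main-conjecture half of its NON-SURJECTIVE X11a twins** — g2's
`missingUpperBoundAt_corner_of_jetchevDivisibility_of_lowerX11a` with the twist input `hLtw` asked only at
X11a pairs `Wd` with `¬ Surj Wd p` and `p ∣ ord_p Δ_min(Wd)` (the leaf), which the Friedberg–Hoffstein twin
of the corner pair IS (§0 `not_surj_twist_model`; `padicValInt_minimalDiscriminantInt_twist_eq`). For
`(E,p) ∈` X11b with `ρ̄` NOT onto, `p ∈ {5,7}`, `p ∣ ord_p Δ_min`, `¬ Ram`: at the Friedberg–Hoffstein field
(`hFHs`) with a Manin-good parametrisation the SHARPENED bound `ord_p #Ш(E/K) + 2t ≤ 2·ord_p[E(K):ℤP]`,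
`t = ord_p ∏c`, comes from Jₚᶜ (`hJ`: `M_∞ ≥ t` on the pair's frames) + Kolyvagin's structure theorem under
irreducibility (`hChaU`) + Darmon 3.6 (`hD36`) + Shimura reciprocity (`hrec`), and descends to `ℚ` with the
twin's `≥`-half (`hLtw`) by x11b3's `missingUpperBoundAt_of_shaIndexBound_sharp`. CONDITIONAL on `hJ`,
`hLtw`, `hChaU`; nothing booked. [cite: Cha2005, Rmk. 25 (p. 175)] [cite: MatarNekovar2019, §0.9, §0.11 (p. 457)]
[cite: McCallumLMS1991, §5 Cor. 5.6 (p. 310)] [cite: Jetchev2008, Conj. 1.3 and (1) (p. 812)]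
[cite: JetchevSkinnerWan2017, §7.4.2 (p. 31)] [cite: Mazur1978, Cor. 4.1] [cite: Miller2011LMS, Def. 1.1]
[cite: SilvermanAEC2009, X.5 Cor. 5.4] -/
theorem missingUpperBoundAt_corner_of_jetchevDivisibility_of_twinLeafLower
    (hGZ : ∀ (N : ℕ) [NeZero N] (W : WeierstrassCurve ℚ) (K : Type) [Field K] [NumberField K],
      gross_zagier N W K)
    (hKo : ∀ (N : ℕ) [NeZero N] (W : WeierstrassCurve ℚ) (K : Type) [Field K] [NumberField K],
      kolyvagin N W K)
    (hGZK : rank_eq_analyticRank_of_analyticRank_le_one) (hmod : hasEntireLFunction_rat)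
    (hnf : exists_isNewformOf) (hFHs : friedbergHoffstein_exists_heegnerField_split_twist_ne_zero)
    (hMaz : mazur_not_dvd_maninConstant_of_odd)
    (hrec : ∀ (N : ℕ) [NeZero N] (W : WeierstrassCurve ℚ) (K : Type) [Field K] [NumberField K],
      heegnerPointOfConductor_one_galoisConj N W K)
    (hD36 : ∀ (N : ℕ) [NeZero N] (W : WeierstrassCurve ℚ) (K : Type) [Field K] [NumberField K],
      phi_heegnerTau_mem_singularModuliField N W K)
    (hChaU : Cha2005.rmk25_padicValNat_card_sha_primary_add_le_of_globalDivisibility)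
    (W : WeierstrassCurve ℚ) [W.IsElliptic] [W.IsGloballyMinimal] (p : ℕ) [Fact p.Prime]
    (hX : ClassX11b W p) (hns : ¬ Surj W p) (h57 : p = 5 ∨ p = 7)
    (hv : p ∣ padicValInt p W.minimalDiscriminantInt) (hnr : ¬ Ram W p)
    -- the `≥`-half of the NON-SURJECTIVE X11a leaf twins at this `p` (hypothesis shape)
    (hLtw : ∀ (Wd : WeierstrassCurve ℚ) [Wd.IsElliptic] [Wd.IsGloballyMinimal],
      ClassX11a Wd p → ¬ Surj Wd p → p ∣ padicValInt p Wd.minimalDiscriminantInt →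
      Typed.MissingLowerBoundAt Wd p)
    -- Jₚᶜ: the Jetchev direction `M_∞ ≥ t` on the corner frames of THIS pair (hypothesis shape)
    (hJ : ∀ [NeZero (W.conductorNorm ℤ)] (K : Type) [Field K] [NumberField K]
      (Dt : ModularParametrizationData W (W.conductorNorm ℤ)) (β : ℤ) (ι : K →+* ℂ),
      IsImaginaryQuadratic K → 4 < (NumberField.discr K).natAbs →
      SatisfiesHeegnerHypothesis (W.conductorNorm ℤ) K → SatisfiesHeegnerHypothesis p K →
      (4 * (W.conductorNorm ℤ : ℤ)) ∣ β ^ 2 - NumberField.discr K → ¬ (p : ℤ) ∣ Dt.c →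
      ∀ (s : ℕ), s ≤ padicValNat p W.tamagawaProduct →
        ∀ (n : ℕ) (d : KolyvaginHeegnerData Dt β ι n), Squarefree n →
          (∀ ℓ ∈ n.primeFactors, Zhang2014.IsKolyvaginPrime (W.conductorNorm ℤ) W K p ℓ ∧
            s ≤ Zhang2014.kolyvaginIndex W p ℓ) → PDiv d p s) :
    Typed.MissingUpperBoundAt W p := by
  have hNS : integral_neronScaling_of_isGloballyMinimal :=
    integral_neronScaling_of_isGloballyMinimal_holds
  haveI : NeZero (W.conductorNorm ℤ) := ⟨(W.conductorNorm_pos_holds).ne'⟩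
  have hp : p.Prime := Fact.out
  have hp5 : 5 ≤ p := by rcases h57 with h | h <;> omega
  have hp2 : p ≠ 2 := by omega
  obtain ⟨hr, _, hmult, hirr⟩ := id hX
  -- a Manin-good parametrisation of level N_E (p² ∤ N)
  have hpN : ¬ p ^ 2 ∣ W.conductorNorm ℤ := not_sq_dvd_conductorNorm_of_mult W p hmult
  obtain ⟨D, hc⟩ := exists_modularParametrizationData_not_dvd hnf hMaz hNS W rfl hp hp2 hpN hirr
  -- the Friedberg–Hoffstein Heegner field: |d_K| > 4, every ℓ ∣ N_E and p split, L(E^{d_K},1) ≠ 0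
  have hw : W.rootNumber = -1 := by
    rw [WeierstrassCurve.rootNumber_eq_neg_one_pow_analyticRank_of_exists_isNewformOf hnf W, hr]
    norm_num
  obtain ⟨K, _, _, hK, hdisc, hHN, hHp, hLt⟩ := hFHs W hw p hp 4
  haveI : IsTotallyComplex K := hK.2
  have hneg : NumberField.discr K < 0 := discr_neg_of_finrank_eq_two K hK.1
  have h4lt : NumberField.discr K < -4 := by
    have habs : ((NumberField.discr K).natAbs : ℤ) = -NumberField.discr K :=
      Int.ofNat_natAbs_of_nonpos hneg.le
    have : (4 : ℤ) < ((NumberField.discr K).natAbs : ℤ) := by exact_mod_cast hdisc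
    omega
  have h3 : NumberField.discr K ≠ -3 := by omega
  have h4 : NumberField.discr K ≠ -4 := by omega
  have hμ : ¬ p ∣ Units.torsionOrder K := by
    rw [Literature.NumberTheory.DiophantineGeometry.torsionOrder_eq_two_of_discr_lt hK.1 h4lt]
    intro h2
    have := Nat.le_of_dvd two_pos h2
    omega
  obtain ⟨H, -⟩ := nonempty_heegnerDatum_holds (W.conductorNorm ℤ) K hK
    (exists_dvd_sq_sub_discr_holds (W.conductorNorm ℤ) K hK hHN).choose_spec
  obtain ⟨ι⟩ : Nonempty (K →+* ℂ) := inferInstance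
  obtain ⟨P, hP⟩ := heegnerPointComplex_mem_range_map_holds (W.conductorNorm ℤ) W K hK hHN D H ι
  -- the minimal twist model: an X11a pair ON THE NON-SURJECTIVE LEAF, and its `≥`-half
  have hD0 : (NumberField.discr K : ℚ) ≠ 0 := by exact_mod_cast NumberField.discr_ne_zero K
  haveI hEt : (W.quadraticTwist (NumberField.discr K : ℚ)).IsElliptic :=
    W.isElliptic_quadraticTwist hD0
  obtain ⟨Cd, hCd⟩ := hasGlobalMinimalModel_rat_holds (W.quadraticTwist (NumberField.discr K : ℚ))
  haveI : (Cd • W.quadraticTwist (NumberField.discr K : ℚ)).IsGloballyMinimal := hCd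
  set Wd := Cd • W.quadraticTwist (NumberField.discr K : ℚ) with hWd_def
  have hWd : Cd • W.quadraticTwist (NumberField.discr K : ℚ) = Wd := rfl
  have hrd : Wd.analyticRank = 0 := by
    rw [hWd_def, analyticRank_smul]
    exact analyticRank_eq_zero_of_entireLFunction_one_ne_zero _ hLt
  have hXa : ClassX11a Wd p := classX11a_twist_of_not_ram W p hX hnr K hK hHN Cd hWd hrd
  have hirrd : Wd.HasIrreducibleModPGaloisRep p := hXa.2.2.2.1
  have hnsd : ¬ Surj Wd p := not_surj_twist_model W p hD0 hns Cd hWd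
  have hpN1 : p ∣ W.conductorNorm ℤ := dvd_conductorNorm_of_mult hmult
  have hsq := isSquare_discr_padic_of_heegner K hK hHN p hpN1
  have hvd : p ∣ padicValInt p Wd.minimalDiscriminantInt := by
    rw [padicValInt_minimalDiscriminantInt_twist_eq W p hD0 hsq Cd hWd]
    exact hv
  obtain ⟨qd, hqd, hvqd⟩ :=
    AdditivePotMult.exists_printShape_lower_of_missingLowerBoundAt_rankZero (p := p) Wd hGZK hrd hirrd
      (hLtw Wd hXa hnsd hvd)
  have htam : padicValNat p Wd.tamagawaProduct = padicValNat p W.tamagawaProduct :=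
    padicValNat_tamagawaProduct_twist_of_heegner W p hp5 K hK hHN Cd hWd
  have hu : padicValRat p (Cd.u : ℚ) = 0 :=
    AdditivePotMult.padicValRat_u_eq_zero_of_twist_minimal_of_split W p K hK hHp Cd hWd
  -- no p-torsion over K (irreducibility)
  have hbot := torsionBy_eq_bot_of_isImaginaryQuadratic_of_hasIrreducibleModPGaloisRep W K hK hp hirr
  have hiv : ∀ x : (W.baseChange K).toAffine.Point, p • x = 0 → x = 0 := fun x hx ↦ by
    have hmem : x ∈ AddSubgroup.torsionBy (W.baseChange K).toAffine.Point ((p : ℕ) : ℤ) := by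
      rw [mem_torsionBy_iff, natCast_zsmul]
      exact hx
    rw [hbot] at hmem
    exact hmem
  -- Darmon's conductor-1 datum on the frame (D, H.β, ι) and its bottom point
  obtain ⟨d₁⟩ := exists_kolyvaginHeegnerData_one (hD36 _ W K) hK D H.β ι H.dvd_sq_sub
  have hPd : d₁.toGeomPoints d₁.derivedPoint = toGeomPoints (W.baseChange K) P :=
    KolyvaginBottom.toGeomPoints_derivedPoint_one_eq (hrec _ W K) hK hHN hP d₁ rfl
  -- descent to ℚ with weight t = ord_p ∏c (x11b3's sharp bookkeeping)
  refine missingUpperBoundAt_of_shaIndexBound_sharp W p (W.conductorNorm ℤ) K D H ι P (hGZ _ W K)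
    (hKo _ W K) hGZK hmod hK hHN hP hp2 hc hμ hr hLt Wd Cd hWd hu htam le_rfl ⟨qd, hqd, hvqd⟩ ?_
  intro hfinK hPinf
  haveI : Finite (W.baseChange K).sha := hfinK
  obtain ⟨hrank, -⟩ := hKo (W.conductorNorm ℤ) W K hK hHN ⟨D, H, ι, hP⟩ hPinf
  exact shaIndexBound_sharp_of_globalDivisibility_of_irreducible hChaU W K p hp2 hmult hirr hK h3 h4 hHN D
    H.β ι d₁ P hPd hPinf hrank hiv (hJ K D H.β ι hK hdisc hHN hHp H.dvd_sq_sub hc)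

/-! ### §2 Crux `NonSurjCorner` ⇐ {Zₚᶜ, Jₚᶜ} + Mazur's main conjecture on the non-surjective X11a leaf -/

open Summit.BirchSwinnertonDyer.BirchSwinnertonDyer.Theses.ErratumRoadFive in
/-- **Crux `NonSurjCorner` (item 19065) ⇐ the refined Kolyvagin conjecture `M_∞ = t` on corner frames
({Zₚᶜ, Jₚᶜ}, two hypothesis shapes) + MAZUR'S MAIN CONJECTURE ON THE NON-SURJECTIVE X11a LEAF at
`p ∈ {5,7}` (`hMC`: `X2.MazurMainConjectureAt Wd p` for every X11a pair `Wd` with `¬ Surj Wd p`,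
`p ∣ ord_p Δ_min(Wd)` — the X11a cell's typed input of record on that leaf, rung K6's object, BY NAME) +
PUBLISHED facts** (Gross–Zagier, Kolyvagin, Wuthrich 2014 Prop. 21, GZK, modularity ×3, Friedberg–Hoffstein
split field, Mazur 1978 Cor. 4.1, Shimura reciprocity, Darmon 3.6, Stein–Wuthrich 2013 Thm. 6.1 ×2,
Greenberg–Stevens, and the two structure facts under irreducibility `hChaL` ∕ `hChaU`). LOWER half of the
corner: g0's `missingLowerBoundAt_of_classX11b_of_indexLowerBoundNoSurj_of_upperTwist` with STEP L at every
Manin-good datum from Zₚᶜ (g2's `indexLowerBoundAt_corner_of_certificates`) and the non-surjective twist's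
Euler-system half from `hMC` (§0); UPPER half: §1 with the twist's `≥`-half from `hMC`. Compared with g2's
`…_of_refinedKolyvagin_of_twin` the binders `X11aLowerHalf` (crux 19064, ALL of X11a) and hT are replaced by
the ONE leaf input; compared with g0's `…_of_openInputNoSurj_of_twinMazurMC` the binders `EulerHalfOffLocus`,
`X11aLowerHalf` and hA (STEP L ∕ IMC on the corner) are gone. CONDITIONAL on `hZ`, `hJ`, `hMC`; does NOT
close item 19065; nothing booked. [cite: Cha2005, Thm. 21 and Rmk. 25 (pp. 173–175)]
[cite: MatarNekovar2019, Thm. 0.7, §0.9, §0.11 (pp. 456–457)] [cite: McCallumLMS1991, §5 Cor. 5.6 (p. 310)]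
[cite: WZhang2014, Thm. 1.1 and Rem. 5 (shape of Zₚᶜ)] [cite: Jetchev2008, Conj. 1.3 (shape of Jₚᶜ)]
[cite: SteinWuthrich2013, Thm. 6.1 (p. 20)] [cite: Skinner2016PacificMC, Thm. A (§1) (shape of hMC)]
[cite: JetchevSkinnerWan2017, §7.4.1–7.4.2 (pp. 30–31)] [cite: Miller2011LMS, Def. 1.1] -/
theorem erratumRoadFive_nonSurjCorner_of_refinedKolyvagin_of_twinLeafMazurMC
    (hGZ : ∀ (N : ℕ) [NeZero N] (W : WeierstrassCurve ℚ) (K : Type) [Field K] [NumberField K],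
      gross_zagier N W K)
    (hKo : ∀ (N : ℕ) [NeZero N] (W : WeierstrassCurve ℚ) (K : Type) [Field K] [NumberField K],
      kolyvagin N W K)
    (hWu : sha_dvd_analyticSha)
    (hGZK : rank_eq_analyticRank_of_analyticRank_le_one) (hmod : hasEntireLFunction_rat)
    (hnf : exists_isNewformOf) (hpar : nonempty_modularParametrizationData)
    (hFHs : friedbergHoffstein_exists_heegnerField_split_twist_ne_zero)
    (hMaz : mazur_not_dvd_maninConstant_of_odd)
    (hrec : ∀ (N : ℕ) [NeZero N] (W : WeierstrassCurve ℚ) (K : Type) [Field K] [NumberField K],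
      heegnerPointOfConductor_one_galoisConj N W K)
    (hD36 : ∀ (N : ℕ) [NeZero N] (W : WeierstrassCurve ℚ) (K : Type) [Field K] [NumberField K],
      phi_heegnerTau_mem_singularModuliField N W K)
    (hJs : thm61_splitMultiplicative) (hJn : thm61_nonsplitMultiplicative)
    (hGS : ∀ (W : WeierstrassCurve ℚ) [W.IsElliptic] [W.IsGloballyMinimal] (p : ℕ) [Fact p.Prime],
      greenberg_stevens (W := W) (p := p))
    (hChaL : Cha2005.rmk25_pow_dvd_card_sha_primary_of_certificate)
    (hChaU : Cha2005.rmk25_padicValNat_card_sha_primary_add_le_of_globalDivisibility)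
    -- Zₚᶜ: certificates on corner frames (`M_∞ ≤ t`)
    (hZ : ∀ (W : WeierstrassCurve ℚ) [W.IsElliptic] [W.IsGloballyMinimal] (p : ℕ) [Fact p.Prime]
      (N : ℕ) [NeZero N] (K : Type) [Field K] [NumberField K]
      (Dt : ModularParametrizationData W N) (β : ℤ) (ι : K →+* ℂ),
      ClassX11b W p → ¬ Surj W p → (p = 5 ∨ p = 7) → p ∣ padicValInt p W.minimalDiscriminantInt →
      ¬ Ram W p → W.conductorNorm ℤ = N → IsImaginaryQuadratic K →
      4 < (NumberField.discr K).natAbs → SatisfiesHeegnerHypothesis N K →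
      SatisfiesHeegnerHypothesis p K → (4 * (N : ℤ)) ∣ β ^ 2 - NumberField.discr K → ¬ (p : ℤ) ∣ Dt.c →
      ∃ M : ℕ, M ≤ padicValNat p W.tamagawaProduct ∧ CertificateAt Dt β ι p M)
    -- Jₚᶜ: the Jetchev direction on corner frames (`M_∞ ≥ t`)
    (hJ : ∀ (W : WeierstrassCurve ℚ) [W.IsElliptic] [W.IsGloballyMinimal] [NeZero (W.conductorNorm ℤ)]
      (p : ℕ) [Fact p.Prime] (K : Type) [Field K] [NumberField K]
      (Dt : ModularParametrizationData W (W.conductorNorm ℤ)) (β : ℤ) (ι : K →+* ℂ),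
      ClassX11b W p → ¬ Surj W p → (p = 5 ∨ p = 7) → p ∣ padicValInt p W.minimalDiscriminantInt →
      ¬ Ram W p → IsImaginaryQuadratic K → 4 < (NumberField.discr K).natAbs →
      SatisfiesHeegnerHypothesis (W.conductorNorm ℤ) K → SatisfiesHeegnerHypothesis p K →
      (4 * (W.conductorNorm ℤ : ℤ)) ∣ β ^ 2 - NumberField.discr K → ¬ (p : ℤ) ∣ Dt.c →
      ∀ (s : ℕ), s ≤ padicValNat p W.tamagawaProduct →
        ∀ (n : ℕ) (d : KolyvaginHeegnerData Dt β ι n), Squarefree n →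
          (∀ ℓ ∈ n.primeFactors, Zhang2014.IsKolyvaginPrime (W.conductorNorm ℤ) W K p ℓ ∧
            s ≤ Zhang2014.kolyvaginIndex W p ℓ) → PDiv d p s)
    -- Mazur's main conjecture on the NON-SURJECTIVE X11a leaf at p ∈ {5,7} (x11a's input (3), by name)
    (hMC : ∀ (Wd : WeierstrassCurve ℚ) [Wd.IsElliptic] [Wd.IsGloballyMinimal] (p : ℕ) [Fact p.Prime],
      ClassX11a Wd p → ¬ Surj Wd p → (p = 5 ∨ p = 7) →
      p ∣ padicValInt p Wd.minimalDiscriminantInt → X2.MazurMainConjectureAt Wd p) :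
    Summit.BirchSwinnertonDyer.BirchSwinnertonDyer.Theses.ErratumRoadFive.NonSurjCorner := by
  intro W _ _ p _ hX hns h57 hv hnr
  have hp5 : 5 ≤ p := by rcases h57 with h | h <;> omega
  -- both Miller halves of every non-surjective-leaf twin at this p, from hMC
  have hleaf : ∀ (Wd : WeierstrassCurve ℚ) [Wd.IsElliptic] [Wd.IsGloballyMinimal],
      ClassX11a Wd p → ¬ Surj Wd p → p ∣ padicValInt p Wd.minimalDiscriminantInt →
      Typed.MissingPPartAt Wd p := fun Wd _ _ hXa hnsd hvd ↦
    missingPPartAt_of_classX11a_of_mazurMainConjectureAt hJs hJn hGZK hmod hpar Wd p (hGS Wd p) hXa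
      (hMC Wd p hXa hnsd h57 hvd)
  refine Typed.missingPPartAt_of_lower_of_upper W p ?_
    (missingUpperBoundAt_corner_of_jetchevDivisibility_of_twinLeafLower hGZ hKo hGZK hmod hnf hFHs hMaz
      hrec hD36 hChaU W p hX hns h57 hv hnr
      (fun Wd _ _ hXa hnsd hvd ↦ (Typed.lower_and_upper_of_missingPPartAt Wd p (hleaf Wd hXa hnsd hvd)).1)
      (fun K _ _ Dt β ι hK hdisc hHN hHp hβ hc ↦
        hJ W p K Dt β ι hX hns h57 hv hnr hK hdisc hHN hHp hβ hc))
  refine missingLowerBoundAt_of_classX11b_of_indexLowerBoundNoSurj_of_upperTwist hGZ hKo hWu hGZK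
    hmod hnf hFHs hMaz W p hX hp5
    (fun N _ K _ _ Dt H ι P hN hK hdisc hHN hHp hLt hP hc hPinf ↦
      indexLowerBoundAt_corner_of_certificates hGZ hKo hmod hrec hD36 hChaL W p N K Dt H ι P hX hp5 hN
        hK hdisc hHN hLt hP hPinf (hZ W p N K Dt H.β ι hX hns h57 hv hnr hN hK hdisc hHN hHp H.dvd_sq_sub hc))
    ?_
  intro K _ _ Wd _ _ Cd hK hHN hLt hWd hnsd
  have hD0 : (NumberField.discr K : ℚ) ≠ 0 := by exact_mod_cast NumberField.discr_ne_zero K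
  haveI : (W.quadraticTwist (NumberField.discr K : ℚ)).IsElliptic := W.isElliptic_quadraticTwist hD0
  have hrd : Wd.analyticRank = 0 := by
    rw [← hWd, analyticRank_smul]
    exact analyticRank_eq_zero_of_entireLFunction_one_ne_zero _ hLt
  have hXa : ClassX11a Wd p := classX11a_twist_of_not_ram W p hX hnr K hK hHN Cd hWd hrd
  have hpN : p ∣ W.conductorNorm ℤ := dvd_conductorNorm_of_mult hX.2.2.1
  have hsq := isSquare_discr_padic_of_heegner K hK hHN p hpN
  have hvd : p ∣ padicValInt p Wd.minimalDiscriminantInt := by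
    rw [padicValInt_minimalDiscriminantInt_twist_eq W p hD0 hsq Cd hWd]
    exact hv
  exact (Typed.lower_and_upper_of_missingPPartAt Wd p (hleaf Wd hXa hnsd hvd)).2

end Summit.BirchSwinnertonDyer.Rank1Residual.X11b

end
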